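import Literature.NumberTheory.Transcendental.BrownMotivicMZV
import Literature.NumberTheory.Transcendental.MultipleZetaValuesDimBoundProofs
import Mathlib.LinearAlgebra.Dimension.OrzechProperty
import Mathlib.LinearAlgebra.LinearIndependent.Lemmas

/-!
# Crux `HoffmanIndependence` (stmt-KontsevichZagierPeriods-15045), line `Sketch`:
# the kernel element (stub A)

Stub `stub_kernelElement` of the lead's skeleton (prime-ideal amplification over Brown's motivic
multiple zeta values `M : Brown2012.MotivicMZV`).

A non-trivial `ℚ`-relation `l` among the REAL Hoffman values `ζ(u)`, `u ∈ {2,3}^×`, of weight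
`≤ N` lifts to the motivic element
`R := ∑_{u} l(u) ζᵐ(u) = Finsupp.linearCombination ℚ (u ↦ Iᵐ(0; ρ(u.reverse); 1)) l`, which is

* non-zero, because the motivic Hoffman family `u ↦ Iᵐ(0; ρ(u.reverse); 1)` on `{2,3}^×` is
  `ℚ`-linearly independent: per weight `N` it consists of `d_N` vectors
  (`zagierDim_eq_card_hoffman_holds`, `finite_hoffman`) spanning `H_N` (hypothesis `hhoff`), a
  space of dimension `d_N` (hypothesis `hdim`), hence it is independent
  (`linearIndependent_iff_card_eq_finrank_span`); across weights the spans sit in the independent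
  pieces `H_N` (hypothesis `hgr : iSupIndep M.Hw`), so the `Σ`-indexed family is independent
  (`linearIndependent_iUnion_finite`), and `{2,3}^×` embeds into `Σ N, {u ∈ {2,3}^× : |u| = N}`
  by `u ↦ ⟨|u|, u⟩`;
* in the filtered piece `H_{≤N} = ⨆_{k≤N} H_k`, since `Iᵐ(0; ρ(u.reverse); 1) ∈ H_{|u|}`
  (`MotivicMZV.J_rho_mem_hoffman`, `weight_reverse`) and `|u| ≤ N` on the support of `l`;
* killed by the period map: `per R = ∑ l(u) ζ(u) = 0` (`MotivicMZV.per_J`, a Hoffman index being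
  admissible).

The pattern (per weight / across weights / `Σ` / reindex) is the one of
`MzvKernelInKZTwoPosetsHoffmanIndependence` for real values, run inside `H`.
No new definitions.
-/

noncomputable section

namespace Summit.KontsevichZagierPeriods.LinRedNormalForm.HoffmanIndependence

open Literature.NumberTheory.Transcendental MZV Brown2012

/-! ## The motivic Hoffman family is linearly independent -/

/-- **Per weight.** If `dim_ℚ H_N = d_N` (`hdim`) and the motivic Hoffman elements
`Iᵐ(0; ρ(w.reverse); 1)`, `w ∈ {2,3}^×` of weight `N`, span `H_N` (`hhoff`), then these `d_N`
elements (`zagierDim_eq_card_hoffman_holds`) are `ℚ`-linearly independent: `d_N` vectors spanning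
a `d_N`-dimensional space. -/
theorem linearIndependent_J_hoffman_weight (M : MotivicMZV)
    (hdim : ∀ N, Module.finrank ℚ (M.Hw N) = zagierDim N)
    (hhoff : ∀ N, Submodule.span ℚ (Set.range
      fun w : {w : List ℕ // IsHoffman w ∧ weight w = N} => M.J (rho w.1.reverse)) = M.Hw N)
    (N : ℕ) :
    LinearIndependent ℚ
      fun w : {w : List ℕ // IsHoffman w ∧ weight w = N} => M.J (rho w.1.reverse) := by
  haveI := finite_hoffman N
  letI := Fintype.ofFinite {w : List ℕ // IsHoffman w ∧ weight w = N}
  rw [linearIndependent_iff_card_eq_finrank_span]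
  unfold Set.finrank
  rw [hhoff N, hdim N, zagierDim_eq_card_hoffman_holds N, Nat.card_eq_fintype_card]

/-- **Across weights.** If the weight pieces `H_N` are independent subspaces of `H` (`hgr`) and
the weight-`N` motivic Hoffman elements span `H_N` (`hhoff`), then the spans of the weight-wise
motivic Hoffman families form an independent family of subspaces. -/
theorem iSupIndep_span_J_hoffman (M : MotivicMZV) (hgr : iSupIndep M.Hw)
    (hhoff : ∀ N, Submodule.span ℚ (Set.range
      fun w : {w : List ℕ // IsHoffman w ∧ weight w = N} => M.J (rho w.1.reverse)) = M.Hw N) :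
    iSupIndep fun N => Submodule.span ℚ (Set.range
      fun w : {w : List ℕ // IsHoffman w ∧ weight w = N} => M.J (rho w.1.reverse)) :=
  hgr.mono fun N => (hhoff N).le

/-- **All weights, `Σ`-indexed.** Under `hgr`, `hdim`, `hhoff`, the motivic Hoffman family
indexed by `Σ N, {w ∈ {2,3}^× : |w| = N}` is `ℚ`-linearly independent
(`linearIndependent_iUnion_finite`). -/
theorem linearIndependent_J_hoffman_sigma (M : MotivicMZV) (hgr : iSupIndep M.Hw)
    (hdim : ∀ N, Module.finrank ℚ (M.Hw N) = zagierDim N)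
    (hhoff : ∀ N, Submodule.span ℚ (Set.range
      fun w : {w : List ℕ // IsHoffman w ∧ weight w = N} => M.J (rho w.1.reverse)) = M.Hw N) :
    LinearIndependent ℚ
      fun ji : Σ N, {w : List ℕ // IsHoffman w ∧ weight w = N} => M.J (rho ji.2.1.reverse) :=
  linearIndependent_iUnion_finite
    (f := fun N (w : {w : List ℕ // IsHoffman w ∧ weight w = N}) => M.J (rho w.1.reverse))
    (linearIndependent_J_hoffman_weight M hdim hhoff)
    fun _ _ _ hit => (iSupIndep_span_J_hoffman M hgr hhoff).disjoint_biSup hit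

/-- **The motivic Hoffman family is linearly independent.** Under `hgr`, `hdim`, `hhoff`, the
family `u ↦ Iᵐ(0; ρ(u.reverse); 1)` indexed by all Hoffman indices `u ∈ {2,3}^×` is
`ℚ`-linearly independent in `H` (transport of the `Σ`-indexed statement along
`u ↦ ⟨|u|, u⟩`). -/
theorem linearIndependent_J_hoffman (M : MotivicMZV) (hgr : iSupIndep M.Hw)
    (hdim : ∀ N, Module.finrank ℚ (M.Hw N) = zagierDim N)
    (hhoff : ∀ N, Submodule.span ℚ (Set.range
      fun w : {w : List ℕ // IsHoffman w ∧ weight w = N} => M.J (rho w.1.reverse)) = M.Hw N) :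
    LinearIndependent ℚ fun u : {u : List ℕ // IsHoffman u} => M.J (rho u.1.reverse) := by
  -- the weight-graded reindexing of the Hoffman indices
  let e : {u : List ℕ // IsHoffman u} → Σ N, {w : List ℕ // IsHoffman w ∧ weight w = N} :=
    fun u => ⟨weight u.1, ⟨u.1, u.2, rfl⟩⟩
  have he : Function.Injective e :=
    Function.Injective.of_comp
      (f := fun ji : Σ N, {w : List ℕ // IsHoffman w ∧ weight w = N} => ji.2.1)
      Subtype.val_injective
  exact (linearIndependent_J_hoffman_sigma M hgr hdim hhoff).comp e he

/-! ## The stub -/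

/-- **Kernel element (stub A).** Over `M : MotivicMZV` with independent weight pieces (`hgr`) of
dimension `d_N` (`hdim`) spanned by the motivic Hoffman elements `Iᵐ(0; ρ(w.reverse); 1)`,
`w ∈ {2,3}^×` of weight `N` (`hhoff`), a non-trivial `ℚ`-relation `l` among the REAL Hoffman
values of weight `≤ N` lifts to a non-zero element `R = ∑ l(u) ζᵐ(u)` of `H_{≤N} = ⨆_{k≤N} H_k`
killed by the period map: `R ≠ 0` by the linear independence of the motivic Hoffman family,
`R ∈ H_{≤N}` since `ζᵐ(u) ∈ H_{|u|}` with `|u| ≤ N`, and `per R = ∑ l(u) ζ(u) = 0` by `per_J`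
(a Hoffman index is admissible). -/
theorem stub_kernelElement : ∀ (M : MotivicMZV), iSupIndep M.Hw →
    (∀ N, Module.finrank ℚ (M.Hw N) = zagierDim N) →
    (∀ N, Submodule.span ℚ (Set.range
      fun w : {w : List ℕ // IsHoffman w ∧ weight w = N} => M.J (rho w.1.reverse)) = M.Hw N) →
    ∀ {N : ℕ} (l : {u : List ℕ // IsHoffman u} →₀ ℚ), l ≠ 0 →
    (∀ u ∈ l.support, weight u.1 ≤ N) →
    (l.sum fun u c => (c : ℝ) * multipleZeta u.1) = 0 →
    ∃ R : M.H, R ≠ 0 ∧ R ∈ (⨆ k ∈ Finset.range (N + 1), M.Hw k) ∧ M.per R = 0 := by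
  intro M hgr hdim hhoff N l hl hwt hrel
  refine ⟨Finsupp.linearCombination ℚ
    (fun u : {u : List ℕ // IsHoffman u} => M.J (rho u.1.reverse)) l, ?_, ?_, ?_⟩
  · -- `R ≠ 0`: the motivic Hoffman family is linearly independent
    exact fun h0 =>
      hl (linearIndependent_iff.mp (linearIndependent_J_hoffman M hgr hdim hhoff) l h0)
  · -- `R ∈ H_{≤N}`
    rw [Finsupp.linearCombination_apply]
    refine Submodule.sum_mem _ fun u hu => Submodule.smul_mem _ _ ?_
    have hmem : M.J (rho u.1.reverse) ∈ M.Hw (weight u.1) := by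
      simpa only [weight_reverse] using M.J_rho_mem_hoffman u.2.reverse
    have hk : weight u.1 ∈ Finset.range (N + 1) :=
      Finset.mem_range.2 (Nat.lt_succ_of_le (hwt u hu))
    refine Submodule.mem_iSup_of_mem (weight u.1) ?_
    exact Submodule.mem_iSup_of_mem hk hmem
  · -- `per R = 0`
    rw [Finsupp.linearCombination_apply, map_finsuppSum, ← hrel]
    refine Finsupp.sum_congr fun u _ => ?_
    rw [map_smul, M.per_J u.1 u.2.isAdmissible, Rat.smul_def]

end Summit.KontsevichZagierPeriods.LinRedNormalForm.HoffmanIndependence
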